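import Summits.QuantumFields.YangMills.Theorems.BalabanUVNodesN22W1RelCentredVertexHeredity
import Summits.QuantumFields.YangMills.Theorems.BalabanUVNodesN18HLayerW1TermIndexed
import Literature.MathematicalPhysics.QuantumFieldTheory.Balaban1983to89.Node00.HistoryTermVertexTower

/-!
# BalabanUVNodes ∕ node N22 = NE9 — THE RELATIVE-DISC CENTRED ROAD OVER THE ADMISSIBLE CLASS, MODULE A0: [I] p.263's INDUCTIVE ASSUMPTION ALONG EVERY HISTORY OF A SLOT-WISE
# DOMAIN FAMILY, FROM THE TERMWISE SCHEMAS — dag-n18-c's single-domain heredity BY NAME («FREEZE ∕ TRUNCATE THE HISTORY»)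

Cell `pub-ymgap`, HUMAN RULING D-0062 (Track A), R134 ACCELERATION re-seat `pub-ymgap-dag-n22-c` (strategy s1), generation 8; first file of the ADMISSIBLE-HISTORY EDITION SWEEP
(lens «transfer» Cards T32∕T33∕T35 + Erratum E9, node00-def-W1 (R-a) and W1-13, this seat's `J10-DESIGN.md` §0).  THEOREMS ONLY.  PORTED, with attribution, from the lens's memo-side
`LensTransferSketch22.lean` §0–§1b (ym-lens-BalabanUVNodes-transfer g22, sha16 58b7be635505913f; farm rc 0) into this seat's namespace.  Imports module R1b `…N22W1RelCentredVertexHeredity`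
(for §1 `recTerm_ofTerms_congr_couplings`), dag-n18-c's `…N18HLayerW1TermIndexed` (for ★ `recAdmissible_ofTerms_of_termwise` BY NAME) and node00-def-W1's storey 10
`Node00/HistoryTermVertexTower` (`recTerm_congr_tower`).  `--supports` K3⁷ `SpineGivenEndpointR13SepCoPH` (stmt-QuantumFields-20544) as a helper.

WHY (lens Card T32 ∕ Erratum E9).  The s1 line's history-universal binders must range over [I] §1 p. 263's ADMISSIBLE older terms — (1.18) on the space tables AND «defined and analytic
on U^c_j» (node00-def-W1 `W1.AdmHist`; dag-n18-c's class) — for the datum's Lemma-2 letters to inhabit them; the heredity (modules R1aᴬ∕R1bᴬ) then needs that class RE-ESTABLISHED for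
the generated older terms along every history it visits.  Those histories are slot-wise: slot `n` ranges over its own domain `D n` (module R1a's family; R1b's interpolation tower even
puts a ball of mock couplings in one slot), so dag-n18-c's `recAdmissible_ofTerms_of_termwise` — ONE coupling set for all slots — does not apply literally.  THIS FILE makes it apply
BY NAME, per history: FREEZE the term-functional family at the history `g` (`k ↦ TF k … (g k) …`, coupling-blind), run N18's theorem at `D := univ` (its termwise hypotheses at any
coupling are the given ones at `g k ∈ D k`), transport back by `recTerm_ofTerms_congr_couplings`; TRUNCATE the family above the run length so that termwise data below `Kr` — all
the R-road has — suffice.  NO induction is re-proved on this seat's side.  Inputs: dag-n18-c's termwise schemas (T-an) (φ-analyticity of every term at admissible older terms) and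
(T-226) (the (2.26) weight bound there), VERBATIM but asked slot-wise (`∀ k, ∀ t ∈ D k`) — ONE producer serves both nodes (lens T33).

WHAT.  §0 the family truncated above `Kr` generates the same levels `≤ Kr` (`olderOf_recTerm_ofTerms_truncBelow`); the frozen family generates the same terms at its history
(`recTerm_ofTerms_freeze`).  §1 ★ `admissible_along_of_termwise_family` (all steps) and ★ `admissibleBelow_along_of_termwise_family` (data below `Kr`, conclusion at the steps
`m ≤ Kr`): along EVERY history `g` with `g n ∈ D n` the generated older terms are (1.18)`(E₀, r₁)`-bounded on the tables AND analytic there — node00-def-W1's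
`W1.RecAdmissibleFam[Below] (GenTower.ofTerms L TF) D (W1.AdmHist sp E₀ r₁)` unfolded (`Iff.rfl` once W1-13 `Node00/HistoryAdmissibleClass` is in the tree; spelled raw here).

HONEST FRAMING.  Count-neutral by-name junction (N18 → N22's heredity); NOT a discharge of N22 or N18.  (T-an), (T-226) are DISPLAYED hypotheses on the term functional of record,
asserted nowhere; one finite four-torus programme at fixed ε — NOT infinite volume, NOT OS on ℝ⁴, NOT a mass gap, NOT Clay.  0 `sorry`, 0 `def`, standard axioms.

References (TYPES only): [I] = [Balaban1987RG1] (0.23) p. 256, Thm 1 p. 259, §1 p. 263 ((1.18) and the clause before it), (2.12)–(2.13) p. 268; [II] = [Balaban1988RG2Cluster] (1.41)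
p. 11, (2.14) p. 15, (2.26) p. 17, Lemma 3 (2.38) p. 20, (2.39)–(2.41) p. 21, p. 22.
-/

noncomputable section

namespace YMDAG.N22.W1

open Set Metric
open scoped BigOperators
open Literature.MathematicalPhysics.QuantumFieldTheory.Balaban1983to89
open Literature.MathematicalPhysics.QuantumFieldTheory.Balaban1983to89.T4Continuum (T4Family)
open Literature.MathematicalPhysics.QuantumFieldTheory.Balaban1983to89.T4OutputRate
open Literature.MathematicalPhysics.QuantumFieldTheory.Balaban1983to89.TreeLengthTorus (TPt TDom tsys torusTreeLen torusTreeLen_nonneg)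
open Literature.MathematicalPhysics.QuantumFieldTheory.Balaban1983to89.B12TreeDecay (K₀ K₀_pos)
open Literature.MathematicalPhysics.QuantumFieldTheory.Balaban1983to89.B13Lemma3TorusData (TBond)
open Literature.MathematicalPhysics.QuantumFieldTheory.Balaban1983to89.B13Lemma3TorusTerms (terms weight weight_nonneg)
open Literature.MathematicalPhysics.QuantumFieldTheory.Balaban1983to89.B13Lemma3TorusSocket (Lemma3Numerics)
open Literature.MathematicalPhysics.QuantumFieldTheory.Balaban1983to89.Node00
open Literature.MathematicalPhysics.QuantumFieldTheory.Balaban1983to89.Node00.Sect2 (domSys domCount CPair)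
open Literature.MathematicalPhysics.QuantumFieldTheory.Balaban1983to89.Node00.W1
open Summit.QuantumFields.YangMills.BalabanUVNodes.N18HLayerW1TermIndexed (recAdmissible_ofTerms_of_termwise)

/-! ## §0 Folklore of the term-indexed recursion: truncation above a run length, freezing at a history -/

section Trunc

variable {P : Params} {𝔸 : Type*} {M : ℕ} [NeZero M] (L : ℕ) [NeZero L]

/-- **THE FAMILY TRUNCATED ABOVE A RUN LENGTH GENERATES THE SAME LEVELS `≤ Kr`**: replacing the term functionals of the steps `k ≥ Kr` by zero does not change the generated
older terms of any step `m ≤ Kr` (those levels read the steps `< m` only — node00-def-W1's `recTerm_congr_tower`); so termwise hypotheses BELOW `Kr` serve an all-steps theorem.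
(lens Sketch22 §0 `olderOf_recTerm_truncFam`, ported with the truncation spelled inline.) [cite: Balaban1987RG1, (0.23) p.256 and (2.13) p.268 (bookkeeping)] -/
theorem olderOf_recTerm_ofTerms_truncBelow (TF : GenTermFun P 𝔸 M L) (g : ℕ → ℂ) {Kr m : ℕ} (hm : m ≤ Kr) :
    olderOf (recTerm (GenTower.ofTerms L fun k => if k < Kr then TF k else 0) g) m = olderOf (recTerm (GenTower.ofTerms L TF) g) m := by
  funext j' Y ψ
  rw [olderOf_apply, olderOf_apply]
  refine recTerm_congr_tower _ _ g j'.1 (fun k hk => ?_) Y ψ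
  rw [GenTower.ofTerms_apply, GenTower.ofTerms_apply]
  exact congrArg (StepGen.ofTerms L) (if_pos ((lt_of_lt_of_le hk (Nat.le_of_lt_succ j'.2)).trans_le hm))

end Trunc

section Freeze

variable (F : T4Family) (K : ℕ) {𝔸 : Type} [NormedRing 𝔸] [NormedAlgebra ℂ 𝔸] {M : ℕ} [NeZero M] (L : ℕ) [NeZero L]

omit [NormedRing 𝔸] [NormedAlgebra ℂ 𝔸] in
/-- **THE FROZEN FAMILY GENERATES THE SAME TERMS AT ITS HISTORY**: `k ↦ (Z, τ, _, old, φ) ↦ TF k Z τ (g k) old φ` (coupling-blind, frozen at `g`) and `TF` generate the same terms at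
`g` — module R1b's `recTerm_ofTerms_congr_couplings` at `rfl` (lens Sketch22 §1, ported). [cite: Balaban1987RG1, (2.12)-(2.13) p.268 (bookkeeping)] -/
theorem recTerm_ofTerms_freeze (TF : GenTermFun (F.P K) 𝔸 M L) (g : ℕ → ℂ) :
    recTerm (GenTower.ofTerms L fun k Z τ (_ : ℂ) old φ => TF k Z τ (g k) old φ) g = recTerm (GenTower.ofTerms L TF) g :=
  funext fun j => funext fun X => funext fun φ =>
    recTerm_ofTerms_congr_couplings F K L (TF₁ := fun k Z τ (_ : ℂ) old φ => TF k Z τ (g k) old φ) (TF₂ := TF) (h := g) (fun _ _ _ _ _ => rfl) j X φ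

/-! ## §1 [I] p. 263's inductive assumption ALONG EVERY HISTORY OF A SLOT-WISE DOMAIN FAMILY — dag-n18-c's theorem by name, per history -/

open Classical in
/-- **★ ADMISSIBILITY ALONG EVERY HISTORY OF A SLOT-WISE DOMAIN FAMILY, FROM THE TERMWISE SCHEMAS ASKED SLOT-WISE.**  For the term-indexed generator `GenTower.ofTerms L TF`, tables
`sp` with the restriction property of [II] p. 15 at every positive level, a domain FAMILY `D : ℕ → Set ℂ` (slot `n` of a history ranges over `D n`) and dag-n18-c's numerals (located
rate clause, STRICT [KP86] clause, renewal `… ≤ E₀`): IF for every step `k`, every coupling `t ∈ D k` and every older-term family `old` that is (1.18)`(E₀, r₁)`-bounded on the tables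
AND analytic at their points, (T-an) every term `φ ↦ TF k Z τ t old φ` is analytic at the points of `sp (k+1) Z` and (T-226) `‖TF k Z τ t old φ‖ ≤ weight(τ)·e^{a₅|Z|}` there —
THEN along EVERY history `g` with `g n ∈ D n` the generated older terms of every step are (1.18)`(E₀, r₁)`-bounded on the tables AND analytic there (node00-def-W1's
`W1.RecAdmissibleFam (GenTower.ofTerms L TF) D (W1.AdmHist sp E₀ r₁)` unfolded).  Proof: dag-n18-c's `recAdmissible_ofTerms_of_termwise` for the family FROZEN at `g`, at `D := univ`,
transported by `recTerm_ofTerms_freeze`.  NO induction re-proved (lens Sketch22 §1, ported with attribution).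
[cite: Balaban1987RG1, §1 p.263 ((1.18) and the clause before it) and Thm 1 p.259; Balaban1988RG2Cluster, (2.14) p.15, (2.26) p.17 and p.22] -/
theorem admissible_along_of_termwise_family (TF : GenTermFun (F.P K) 𝔸 M L) (D : ℕ → Set ℂ)
    (sp : (j : ℕ) → (domSys (F.P K) M j).Dom → Set (CPair (F.P K) 𝔸)) {E₀ r₁ : ℝ} (hrestr : ∀ k, SpRestr (sp (k + 1)))
    (c : B13.Consts) (hL : 8 ≤ c.L) (hLc : c.L = L) {a a₂ a₂' a₅ Aabs : ℝ} (hN : Lemma3Numerics c M ((c.L : ℝ) / 2) a a₂ a₂' a₅ Aabs)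
    (hTan : ∀ k : ℕ, ∀ t ∈ D k, ∀ old : OlderTerms (F.P K) 𝔸 M k,
      (∀ (j : Fin (k + 1)) (Y : (domSys (F.P K) M j).Dom), ∀ ψ ∈ sp j Y,
          ‖old j Y ψ‖ ≤ E₀ * Real.exp (-(r₁ * (domSys (F.P K) M j).dj Y))) →
      (∀ (j : Fin (k + 1)) (Y : (domSys (F.P K) M j).Dom), AnalyticOnNhd ℂ (old j Y) (sp j Y)) →
      ∀ (Z : (domSys (F.P K) M (k + 1)).Dom), ∀ τ ∈ terms L M Z, AnalyticOnNhd ℂ (fun φ => TF k Z τ t old φ) (sp (k + 1) Z))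
    (hT226 : ∀ k : ℕ, ∀ t ∈ D k, ∀ old : OlderTerms (F.P K) 𝔸 M k,
      (∀ (j : Fin (k + 1)) (Y : (domSys (F.P K) M j).Dom), ∀ ψ ∈ sp j Y,
          ‖old j Y ψ‖ ≤ E₀ * Real.exp (-(r₁ * (domSys (F.P K) M j).dj Y))) →
      (∀ (j : Fin (k + 1)) (Y : (domSys (F.P K) M j).Dom), AnalyticOnNhd ℂ (old j Y) (sp j Y)) →
      ∀ (Z : (domSys (F.P K) M (k + 1)).Dom) (φ : CPair (F.P K) 𝔸), φ ∈ sp (k + 1) Z → ∀ τ ∈ terms L M Z,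
        ‖TF k Z τ t old φ‖ ≤ weight L M c Z a τ * Real.exp (a₅ * ((Z.1).card : ℝ)))
    (hr₁ : 0 ≤ r₁) (hA : 0 ≤ c.C3act * c.ε₁) (hrate : r₁ + 2 * (64 * Real.log 162) + 2 ≤ (1 - 8 * c.δ) * ((c.L : ℝ) / 2) * c.κ)
    (hsmall : c.C3act * c.ε₁ * Real.exp (5 * r₁ + 1) * K₀ 64 8 * 9 * 64 < 1)
    (hrenew : Real.exp 1 * 9 * 64 * K₀ 64 8 ^ 2 * (c.C3act * c.ε₁) ≤ E₀)
    (g : ℕ → ℂ) (hg : ∀ n, g n ∈ D n) (m : ℕ) :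
    (∀ (j : Fin (m + 1)) (Y : (domSys (F.P K) M j).Dom), ∀ ψ ∈ sp j Y,
        ‖olderOf (recTerm (GenTower.ofTerms L TF) g) m j Y ψ‖ ≤ E₀ * Real.exp (-(r₁ * (domSys (F.P K) M j).dj Y))) ∧
      (∀ (j : Fin (m + 1)) (Y : (domSys (F.P K) M j).Dom), AnalyticOnNhd ℂ (olderOf (recTerm (GenTower.ofTerms L TF) g) m j Y) (sp j Y)) := by
  -- ported from lens Sketch22 §1 (ym-lens-BalabanUVNodes-transfer g22), with attribution
  have hAdm := recAdmissible_ofTerms_of_termwise F K L (fun k Z τ (_ : ℂ) old φ => TF k Z τ (g k) old φ) Set.univ sp hrestr c hL hLc hN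
    (fun k _ _ old hB hAn => hTan k (g k) (hg k) old hB hAn) (fun k _ _ old hB hAn => hT226 k (g k) (hg k) old hB hAn) hr₁ hA hrate hsmall hrenew
  have h := hAdm g (fun _ => Set.mem_univ _) m
  rw [recTerm_ofTerms_freeze F K L TF g] at h
  exact h

open Classical in
/-- **★ THE SAME BELOW A RUN LENGTH** — the form the R-road consumes (its termwise data exist for the steps below the run only): (T-an), (T-226) at the steps `k < Kr`, slot-wise on
`D`, give the admissibility ((1.18)`(E₀, r₁)` on the tables ∧ analytic there) of the generated older terms of every step `m ≤ Kr` along every history `g` with `g n ∈ D n`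
(node00-def-W1's `W1.RecAdmissibleFamBelow (GenTower.ofTerms L TF) D (W1.AdmHist sp E₀ r₁) (Kr + 1)` unfolded).  Proof: §1 for the family truncated above `Kr` (zero terms are
analytic and weight-bounded), read back on the levels `≤ Kr` by `olderOf_recTerm_ofTerms_truncBelow` (lens Sketch22 §1b, ported with attribution).
[cite: Balaban1987RG1, §1 p.263, (0.23) p.256 and (2.13) p.268; Balaban1988RG2Cluster, (2.14) p.15, (2.26) p.17 and p.22] -/
theorem admissibleBelow_along_of_termwise_family (TF : GenTermFun (F.P K) 𝔸 M L) (D : ℕ → Set ℂ)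
    (sp : (j : ℕ) → (domSys (F.P K) M j).Dom → Set (CPair (F.P K) 𝔸)) {E₀ r₁ : ℝ} (hrestr : ∀ k, SpRestr (sp (k + 1)))
    (c : B13.Consts) (hL : 8 ≤ c.L) (hLc : c.L = L) {a a₂ a₂' a₅ Aabs : ℝ} (hN : Lemma3Numerics c M ((c.L : ℝ) / 2) a a₂ a₂' a₅ Aabs) (Kr : ℕ)
    (hTan : ∀ k : ℕ, k < Kr → ∀ t ∈ D k, ∀ old : OlderTerms (F.P K) 𝔸 M k,
      (∀ (j : Fin (k + 1)) (Y : (domSys (F.P K) M j).Dom), ∀ ψ ∈ sp j Y,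
          ‖old j Y ψ‖ ≤ E₀ * Real.exp (-(r₁ * (domSys (F.P K) M j).dj Y))) →
      (∀ (j : Fin (k + 1)) (Y : (domSys (F.P K) M j).Dom), AnalyticOnNhd ℂ (old j Y) (sp j Y)) →
      ∀ (Z : (domSys (F.P K) M (k + 1)).Dom), ∀ τ ∈ terms L M Z, AnalyticOnNhd ℂ (fun φ => TF k Z τ t old φ) (sp (k + 1) Z))
    (hT226 : ∀ k : ℕ, k < Kr → ∀ t ∈ D k, ∀ old : OlderTerms (F.P K) 𝔸 M k,
      (∀ (j : Fin (k + 1)) (Y : (domSys (F.P K) M j).Dom), ∀ ψ ∈ sp j Y,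
          ‖old j Y ψ‖ ≤ E₀ * Real.exp (-(r₁ * (domSys (F.P K) M j).dj Y))) →
      (∀ (j : Fin (k + 1)) (Y : (domSys (F.P K) M j).Dom), AnalyticOnNhd ℂ (old j Y) (sp j Y)) →
      ∀ (Z : (domSys (F.P K) M (k + 1)).Dom) (φ : CPair (F.P K) 𝔸), φ ∈ sp (k + 1) Z → ∀ τ ∈ terms L M Z,
        ‖TF k Z τ t old φ‖ ≤ weight L M c Z a τ * Real.exp (a₅ * ((Z.1).card : ℝ)))
    (hr₁ : 0 ≤ r₁) (hA : 0 ≤ c.C3act * c.ε₁) (hrate : r₁ + 2 * (64 * Real.log 162) + 2 ≤ (1 - 8 * c.δ) * ((c.L : ℝ) / 2) * c.κ)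
    (hsmall : c.C3act * c.ε₁ * Real.exp (5 * r₁ + 1) * K₀ 64 8 * 9 * 64 < 1)
    (hrenew : Real.exp 1 * 9 * 64 * K₀ 64 8 ^ 2 * (c.C3act * c.ε₁) ≤ E₀)
    (g : ℕ → ℂ) (hg : ∀ n, g n ∈ D n) (m : ℕ) (hm : m ≤ Kr) :
    (∀ (j : Fin (m + 1)) (Y : (domSys (F.P K) M j).Dom), ∀ ψ ∈ sp j Y,
        ‖olderOf (recTerm (GenTower.ofTerms L TF) g) m j Y ψ‖ ≤ E₀ * Real.exp (-(r₁ * (domSys (F.P K) M j).dj Y))) ∧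
      (∀ (j : Fin (m + 1)) (Y : (domSys (F.P K) M j).Dom), AnalyticOnNhd ℂ (olderOf (recTerm (GenTower.ofTerms L TF) g) m j Y) (sp j Y)) := by
  -- ported from lens Sketch22 §1b (ym-lens-BalabanUVNodes-transfer g22), with attribution; truncation spelled inline
  have hA6 : 0 ≤ c.α₆ * c.eps2 := mul_nonneg hN.hα₆.le hN.hε₀
  rw [← olderOf_recTerm_ofTerms_truncBelow L TF g hm]
  refine admissible_along_of_termwise_family F K L (fun k => if k < Kr then TF k else 0) D sp hrestr c hL hLc hN ?_ ?_ hr₁ hA hrate hsmall hrenew g hg m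
  · intro k t ht old hB hAn Z τ hτ
    by_cases hk : k < Kr
    · simp only [if_pos hk]; exact hTan k hk t ht old hB hAn Z τ hτ
    · simp only [if_neg hk]; exact analyticOnNhd_const
  · intro k t ht old hB hAn Z φ hφ τ hτ
    by_cases hk : k < Kr
    · simp only [if_pos hk]; exact hT226 k hk t ht old hB hAn Z φ hφ τ hτ
    · simp only [if_neg hk, Pi.zero_apply, norm_zero]
      exact mul_nonneg (weight_nonneg c Z a hA6 τ) (Real.exp_nonneg _)

end Freeze

end YMDAG.N22.W1

end
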